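import Mathlib.Analysis.SpecialFunctions.Pow.Asymptotics
import Literature.Computability.Complexity.CSPToCMMSASoundness
import Literature.Computability.Complexity.GapCSPQueried
import Literature.Computability.Complexity.PromiseProofs
import HarnessLib

/-!
# Complexity core: the Dinur–Safra reduction from gap CSPs to CMMSA, III — Hirahara's Thm. 5.2 from Lemma 5.3

Third file on Hirahara's proof of Thm. 5.2 (ECCC TR22-119, pp. 16–18). Files I–II
(`CSPToCMMSA.lean`, `CSPToCMMSASoundness.lean`) prove completeness, the degree bound and the
quantitative soundness of the instance map `Ψ ↦ (Φ, w, s)`. Here we assemble the **Karp reduction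
of promise problems** `gapCSPQueried D Q δ ≤ₚ gapCMMSA (Δ^α) (Δ^{-α}) Δ`, `Δ = sqrtLog`, at the
parameters of the paper (`Δ(n) = (log n)^{1/2}`, proof of Thm. 8.5), and derive the named fact
`Hirahara2022_thm52_sqrtLog` (`MetaComplexity/CMMSA.lean`) from the sliding-scale PCP in compact
MaxCSP form (`Hirahara2022_lem53_logPow_queried`, `GapCSPQueried.lean`) and one routine
implementation fact (`dinurSafraMap_mem_FP`: the instance map is polynomial-time computable on codes).

## The reduction and its parameters (proof of Thm. 5.2, p. 18)

Given the PCP constants `D ≥ 1` (queries) and `c` (alphabet `|Σ| ≤ (log₂ n)^{cγ}` at soundness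
`(log₂ n)^{-γ}`), take `γ := 1 / (4 (c + 1) D)` (so that the degree `|Σ|^D · D ≤ D (log₂ n)^{1/4}`
stays below `Δ = ⌊√⌊log₂ ·⌋⌋`, Hirahara's "we choose `δ := Δ^{-Θ(1/D)}` so that the degree of `Φ`
is at most `Δ`") and `α := γ / (2 (2D + 1))` (the gap exponent, Hirahara's `Δ^{Θ(1/D²)}`): by
`toCMMSA_sound` an assignment of weight `≤ Δ^α · s` satisfying a `Δ^{-α}`-fraction of `Φ` would
give a CSP assignment satisfying a `2^{-(D+1)} D^{-D} Δ^{-α(2D+1)} ≥ (log₂ n)^{-γ}` fraction of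
`Ψ`. Both estimates hold once `log₂ n` exceeds a constant `L₀` (`exists_threshold`); instances
with `n ≤ N₀ := 2^{L₀}` variables — whose alphabet is then bounded by the constant
`Q₀ := ⌈(log₂ N₀)^{cγ}⌉` — are solved outright by the reduction (at most `Q₀^{N₀}` assignments)
and mapped to the fixed instances `trivialYesCMMSA` / `trivialNoCMMSA`, the standard patch making
a Karp reduction correct at every size. The patched map is `dinurSafraMap N₀ Q₀`; it applies
`CSPInstance.toCMMSA` only when `n, |Σ| ≤ Σⱼ |dom Cⱼ|` (true on the promise of `gapCSPQueried`,
where every variable is queried), which keeps its output polynomial in the input on *all*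
strings.

## Contents

* `trivialYesCMMSA`, `trivialNoCMMSA` and their membership in every `CMMSA.yesSet Δ` /
  `CMMSA.noSet g ε Δ` with `ε 2 > 0`;
* `dinurSafraMap N₀ Q₀` — the patched instance map; `dinurSafraMap_mem_FP` — the named implementation fact;
* `toCMMSA_mem_yesSet`, `toCMMSA_mem_noSet` — the large-instance cases from files I–II;
* `exists_threshold` — the two eventual parameter inequalities;
* `Hirahara2022_thm52_sqrtLog_of_lem53` — **Thm. 5.2 at `Δ(n) = (log n)^{1/2}` from Lemma 5.3**.

## References

* S. Hirahara, *NP-hardness of learning programs and partial MCSP*, FOCS 2022; ECCC TR22-119: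
  Thm. 5.2 and its proof (pp. 16–18), Lemma 5.3.
* O. Goldreich, *On promise problems: a survey*, LNCS 3895 (2006), Def. 1.4 (Karp reductions of
  promise problems).
* S. Arora, B. Barak, *Computational Complexity: A Modern Approach*, CUP 2009, §2.1
  (polynomial-time reductions; finitely many instances may be hard-wired).
-/

namespace Literature.Computability.Complexity

open _root_.Computability MetaComplexity Filter

/-! ### Two fixed CMMSA instances -/

/-- A fixed yes-instance of CMMSA at every degree bound: no variables, no formulas, threshold `0`
(the empty assignment has weight `0` and satisfies every formula of the empty collection).
[cite: Hirahara2022PartialMCSP, Def. 5.1 (Yes case)] -/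
def trivialYesCMMSA : CMMSAInstance := ⟨0, [], [], 0⟩

/-- A fixed no-instance of CMMSA for every gap and every positive soundness at size `2`: two
idle variables and the single identically-false DNF `⊥` (no terms), which no assignment
satisfies. [cite: Hirahara2022PartialMCSP, Def. 5.1 (No case)] -/
def trivialNoCMMSA : CMMSAInstance := ⟨2, [[]], [0, 0], 0⟩

/-- `trivialYesCMMSA ∈ CMMSA.yesSet Δ` for every `Δ`. [cite: Hirahara2022PartialMCSP, Def. 5.1 (Yes case)] -/
theorem trivialYesCMMSA_mem_yesSet (Δ : ℕ → ℕ) : trivialYesCMMSA ∈ CMMSA.yesSet Δ := by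
  refine ⟨⟨rfl, fun φ hφ => by simp [trivialYesCMMSA] at hφ⟩, ?_, fun _ => false, ?_,
    fun φ hφ => by simp [trivialYesCMMSA] at hφ⟩
  · simp [trivialYesCMMSA, CMMSAInstance.degree]
  · simp [trivialYesCMMSA, CMMSAInstance.weightOf]

/-- `trivialNoCMMSA ∈ CMMSA.noSet g ε Δ` whenever `ε 2 > 0` (its only formula is never
satisfied, so `#{j | φⱼ(α) = 1} = 0 < ε(2) · 1`). [cite: Hirahara2022PartialMCSP, Def. 5.1 (No case)] -/
theorem trivialNoCMMSA_mem_noSet {g ε : ℕ → ℝ} {Δ : ℕ → ℕ} (hε : 0 < ε 2) :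
    trivialNoCMMSA ∈ CMMSA.noSet g ε Δ := by
  refine ⟨⟨rfl, ?_⟩, ?_, fun a _ => ?_⟩
  · intro φ hφ
    simp only [trivialNoCMMSA, List.mem_singleton] at hφ
    subst hφ
    intro t ht
    simp at ht
  · simp [trivialNoCMMSA, CMMSAInstance.degree, MonotoneDNF.numLiterals]
  · have h0 : trivialNoCMMSA.satCount a = 0 := by
      simp [trivialNoCMMSA, CMMSAInstance.satCount]
    have h1 : trivialNoCMMSA.numFormulas = 1 := rfl
    have h2 : trivialNoCMMSA.numVars = 2 := rfl
    rw [h0, h1, h2]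
    simpa using hε

/-! ### The patched instance map -/

open Classical in
/-- **The reduction of the proof of Thm. 5.2, patched at small sizes.** On well-formed instances
with at most `N₀` variables and alphabet at most `Q₀` the map decides satisfiability outright
(finitely many assignments `[N₀] → [Q₀]` matter) and outputs `trivialYesCMMSA` or
`trivialNoCMMSA`; otherwise it outputs the Dinur–Safra instance `Ψ.toCMMSA` (`CSPToCMMSA.lean`),
provided `n` and `|Σ|` are at most the total arity `Σⱼ |dom Cⱼ|` (so that its `n · max |Σ| 1`
unary-weighted literals are polynomially many; automatic on the promise of `gapCSPQueried`), and
`trivialNoCMMSA` on the remaining (off-promise) inputs. [cite: Hirahara2022PartialMCSP, proof of Thm. 5.2 (p. 16), with the standard finite patch (Arora–Barak 2009, §2.1)] -/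
noncomputable def dinurSafraMap (N₀ Q₀ : ℕ) (Ψ : CSPInstance) : CMMSAInstance :=
  if Ψ.WellFormed ∧ Ψ.numVars ≤ N₀ ∧ Ψ.alphabetSize ≤ Q₀ then
    (if Ψ.IsSatisfiable then trivialYesCMMSA else trivialNoCMMSA)
  else if Ψ.numVars ≤ Ψ.totalArity ∧ Ψ.alphabetSize ≤ Ψ.totalArity then Ψ.toCMMSA
  else trivialNoCMMSA

/-- **Named implementation fact: the patched Dinur–Safra map is polynomial-time computable on
codes.** For all constants `N₀, Q₀` there is `f ∈ FP` with
`f (code Ψ) = code (dinurSafraMap N₀ Q₀ Ψ)` for every MaxCSP instance `Ψ` (codes: `CSPInstance.encoding`,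
binary numbers and nested lists; `CMMSAInstance.encoding`, weights in unary). Routine: parse the
nested lists; on well-formed instances with `n ≤ N₀`, `|Σ| ≤ Q₀` try the at most `Q₀^{N₀}`
relevant assignments (a constant), each checked by one scan; otherwise, when `n, |Σ| ≤ Σⱼ|dom Cⱼ|`,
write the `n · max |Σ| 1 ≤ |Ψ|²` literals, the formulas `φⱼ` (one literal per entry of an
accepting local assignment), the occurrence counts `|Ψ(x)| ≤ m` in unary and `s = Σⱼ |dom Cⱼ|`,
all of size polynomial in `|code Ψ|`. Hirahara: "it is NP-hard under polynomial-time many-one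
reductions … Given the MaxCSP instance `Ψ` over `Σ`, we reduce it to an instance `(Φ, w, s)` of
CMMSA as follows". Vendored as a fact pending a machine-level (`FP`, Mathlib `TM2`) implementation.
[cite: Hirahara2022PartialMCSP, Thm. 5.2 and its proof (p. 16, the reduction is polynomial-time)] -/
def dinurSafraMap_mem_FP : Prop :=
  ∀ N₀ Q₀ : ℕ, ∃ f ∈ FP, ∀ Ψ : CSPInstance,
    f (CSPInstance.encoding.encode Ψ) = CMMSAInstance.encoding.encode (dinurSafraMap N₀ Q₀ Ψ)

/-! ### The large-instance cases -/

namespace CSPInstance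

/-- **Yes case.** A satisfiable well-formed instance of arity `D` whose degree bound
`|Σ|^D · D` is at most `Δ(n · q₁)` is mapped into `CMMSA.yesSet Δ` (completeness,
`toCMMSA_complete`, and the degree bound `degree_toCMMSA_le_pow`). [cite: Hirahara2022PartialMCSP, proof of Thm. 5.2 (p. 17, completeness; p. 18, degree)] -/
theorem toCMMSA_mem_yesSet {Ψ : CSPInstance} {D : ℕ} (hwf : Ψ.WellFormed) (hD : Ψ.HasArity D)
    (hsat : Ψ.IsSatisfiable) {Δ : ℕ → ℕ}
    (hdeg : Ψ.alphabetSize ^ D * D ≤ Δ (Ψ.numVars * Ψ.litWidth)) :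
    Ψ.toCMMSA ∈ CMMSA.yesSet Δ :=
  ⟨toCMMSA_wellFormed hwf, (degree_toCMMSA_le_pow hwf hD).trans (by simpa using hdeg),
    toCMMSA_complete hwf hsat⟩

/-- **No case.** If every CSP assignment satisfies fewer than `δ · m` constraints, the degree
bound holds, and the parameters at the output size `n' = n · q₁` satisfy `g(n'), ε(n') > 0` and
`δ ≤ (ε/2) · (ε/(2gD))^D`, then the image lies in `CMMSA.noSet g ε Δ`: an assignment of weight
`≤ g · s` satisfying `≥ ε · m` formulas would, by `toCMMSA_sound`, give a CSP assignment
satisfying `≥ δ · m` constraints. [cite: Hirahara2022PartialMCSP, proof of Thm. 5.2 (pp. 17–18, soundness)] -/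
theorem toCMMSA_mem_noSet {Ψ : CSPInstance} {D : ℕ} (hwf : Ψ.WellFormed) (hD : Ψ.HasArity D)
    (hDpos : 0 < D) {δ : ℝ} (hno : ∀ a : ℕ → ℕ, (Ψ.satCount a : ℝ) < δ * Ψ.numConstraints)
    {g ε : ℕ → ℝ} {Δ : ℕ → ℕ} (hdeg : Ψ.alphabetSize ^ D * D ≤ Δ (Ψ.numVars * Ψ.litWidth))
    (hg : 0 < g (Ψ.numVars * Ψ.litWidth)) (hε : 0 < ε (Ψ.numVars * Ψ.litWidth))
    (hparam : δ ≤ ε (Ψ.numVars * Ψ.litWidth) / 2 *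
      (ε (Ψ.numVars * Ψ.litWidth) / (2 * g (Ψ.numVars * Ψ.litWidth) * D)) ^ D) :
    Ψ.toCMMSA ∈ CMMSA.noSet g ε Δ := by
  refine ⟨toCMMSA_wellFormed hwf, (degree_toCMMSA_le_pow hwf hD).trans (by simpa using hdeg),
    fun a ha => ?_⟩
  rw [toCMMSA_numVars] at ha ⊢
  rw [numFormulas_toCMMSA]
  by_contra hlt
  push Not at hlt
  obtain ⟨σ, hσ⟩ := toCMMSA_sound hwf hD hDpos hg hε a ha hlt
  have hm : (0 : ℝ) ≤ Ψ.numConstraints := Nat.cast_nonneg _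
  have h1 : δ * Ψ.numConstraints ≤ Ψ.satCount σ :=
    (mul_le_mul_of_nonneg_right hparam hm).trans hσ
  exact absurd (hno σ) (not_lt.2 h1)

end CSPInstance

/-! ### The parameter thresholds -/

/-- **The two eventual estimates of the proof of Thm. 5.2** at `Δ(n) = (log n)^{1/2}`, in the
variable `L = ⌊log₂ n⌋`: for all large `L`, (degree) `D · L^{1/4} + 1 ≤ √L`, and (gap)
`2^{D+1} D^D (3L)^{γ/4} ≤ L^γ`. Both because a fixed positive power of `L` eventually dominates any
constant (Hirahara: "we choose `δ := Δ^{-Θ(1/D)}` so that the degree of `Φ` is at most `Δ`. Then,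
the gap `g` is at least `Ω(δ^{-1/2D}) ≥ Δ^{Θ(1/D²)}`"). [cite: Hirahara2022PartialMCSP, proof of Thm. 5.2 (p. 18, choice of parameters)] -/
theorem exists_threshold (D : ℕ) {γ : ℝ} (hγ : 0 < γ) :
    ∃ L₀ : ℕ, ∀ L : ℕ, L₀ ≤ L →
      1 ≤ L ∧ (D : ℝ) * (L : ℝ) ^ ((1 : ℝ) / 4) + 1 ≤ Real.sqrt L ∧
        (2 : ℝ) ^ (D + 1) * (D : ℝ) ^ D * ((3 : ℝ) * L) ^ (γ / 4) ≤ (L : ℝ) ^ γ := by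
  have hcast : Tendsto (fun L : ℕ => (L : ℝ)) atTop atTop := tendsto_natCast_atTop_atTop
  have h1 : ∀ᶠ L : ℕ in atTop, 1 ≤ L := eventually_ge_atTop 1
  have h2 : ∀ᶠ L : ℕ in atTop, (D : ℝ) + 1 ≤ (L : ℝ) ^ ((1 : ℝ) / 4) :=
    ((tendsto_rpow_atTop (by norm_num : (0 : ℝ) < 1 / 4)).comp hcast).eventually_ge_atTop _
  have h3 : ∀ᶠ L : ℕ in atTop,
      (2 : ℝ) ^ (D + 1) * (D : ℝ) ^ D * (3 : ℝ) ^ (γ / 4) ≤ (L : ℝ) ^ (3 * γ / 4) :=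
    ((tendsto_rpow_atTop (by positivity : (0 : ℝ) < 3 * γ / 4)).comp hcast).eventually_ge_atTop _
  obtain ⟨L₀, hL₀⟩ := eventually_atTop.1 (h1.and (h2.and h3))
  refine ⟨L₀, fun L hL => ?_⟩
  obtain ⟨hL1, hL2, hL3⟩ := hL₀ L hL
  have hLr : (1 : ℝ) ≤ L := by exact_mod_cast hL1
  have hLpos : (0 : ℝ) < L := by linarith
  refine ⟨hL1, ?_, ?_⟩
  · have hq1 : (1 : ℝ) ≤ (L : ℝ) ^ ((1 : ℝ) / 4) := Real.one_le_rpow hLr (by norm_num)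
    have hsqrt : Real.sqrt L = (L : ℝ) ^ ((1 : ℝ) / 4) * (L : ℝ) ^ ((1 : ℝ) / 4) := by
      rw [Real.sqrt_eq_rpow, ← Real.rpow_add hLpos]
      norm_num
    rw [hsqrt]
    have hD0 : (0 : ℝ) ≤ D := Nat.cast_nonneg _
    nlinarith
  · have hsplit : (L : ℝ) ^ γ = (L : ℝ) ^ (γ / 4) * (L : ℝ) ^ (3 * γ / 4) := by
      rw [← Real.rpow_add hLpos]
      congr 1
      ring
    have hmul : ((3 : ℝ) * L) ^ (γ / 4) = (3 : ℝ) ^ (γ / 4) * (L : ℝ) ^ (γ / 4) :=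
      Real.mul_rpow (by norm_num) hLpos.le
    rw [hsplit, hmul]
    have hq : (0 : ℝ) ≤ (L : ℝ) ^ (γ / 4) := Real.rpow_nonneg hLpos.le _
    calc (2 : ℝ) ^ (D + 1) * (D : ℝ) ^ D * ((3 : ℝ) ^ (γ / 4) * (L : ℝ) ^ (γ / 4))
        = ((2 : ℝ) ^ (D + 1) * (D : ℝ) ^ D * (3 : ℝ) ^ (γ / 4)) * (L : ℝ) ^ (γ / 4) := by ring
      _ ≤ (L : ℝ) ^ (3 * γ / 4) * (L : ℝ) ^ (γ / 4) := mul_le_mul_of_nonneg_right hL3 hq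
      _ = (L : ℝ) ^ (γ / 4) * (L : ℝ) ^ (3 * γ / 4) := by ring

/-- **Degree estimate.** If `|Σ| ≤ L^{cγ}` with `cγD ≤ 1/4` and `D · L^{1/4} + 1 ≤ √L` (`L ≥ 1`),
then `|Σ|^D · D ≤ ⌊√L⌋` (Hirahara: "we choose `δ` so that the degree of `Φ` is at most `Δ`").
[cite: Hirahara2022PartialMCSP, proof of Thm. 5.2 (p. 18, degree at most Δ)] -/
theorem pow_mul_le_nat_sqrt {q D c L : ℕ} {γ : ℝ} (hL1 : 1 ≤ L)
    (hq : (q : ℝ) ≤ (L : ℝ) ^ ((c : ℝ) * γ)) (hcγD : (c : ℝ) * γ * D ≤ 1 / 4)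
    (hcond : (D : ℝ) * (L : ℝ) ^ ((1 : ℝ) / 4) + 1 ≤ Real.sqrt L) :
    q ^ D * D ≤ Nat.sqrt L := by
  have hLr : (1 : ℝ) ≤ L := by exact_mod_cast hL1
  have hL0 : (0 : ℝ) ≤ L := by linarith
  have hqD : (q : ℝ) ^ D ≤ (L : ℝ) ^ ((1 : ℝ) / 4) := by
    calc (q : ℝ) ^ D ≤ ((L : ℝ) ^ ((c : ℝ) * γ)) ^ D :=
          pow_le_pow_left₀ (Nat.cast_nonneg _) hq D
      _ = (L : ℝ) ^ ((c : ℝ) * γ * D) := by rw [← Real.rpow_natCast, ← Real.rpow_mul hL0]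
      _ ≤ (L : ℝ) ^ ((1 : ℝ) / 4) := Real.rpow_le_rpow_of_exponent_le hLr hcγD
  have h1 : ((q ^ D * D : ℕ) : ℝ) ≤ (D : ℝ) * (L : ℝ) ^ ((1 : ℝ) / 4) := by
    push_cast
    rw [mul_comm]
    exact mul_le_mul_of_nonneg_left hqD (Nat.cast_nonneg _)
  have h2 : Real.sqrt L < Nat.sqrt L + 1 := Real.real_sqrt_lt_nat_sqrt_succ
  have hlt : ((q ^ D * D : ℕ) : ℝ) < (Nat.sqrt L : ℕ) := by linarith
  exact (Nat.cast_lt.1 hlt).le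

/-- **Gap estimate.** With `α (2D+1) = γ/2`, `1 ≤ s ≤ √(3L)` and `2^{D+1} D^D (3L)^{γ/4} ≤ L^γ`
(`L ≥ 1`): `L^{-γ} ≤ (ε/2) · (ε/(2gD))^D` for `g = s^α`, `ε = s^{-α}` — the right-hand side being
`1 / (2^{D+1} D^D s^{α(2D+1)})` (Hirahara: "the gap `g` is at least `Ω(δ^{-1/2D}) ≥ Δ^{Θ(1/D²)}`.
Moreover, the soundness `ε` is at least `δ^{1/4D} ≥ Δ^{-Θ(1/D²)}`").
[cite: Hirahara2022PartialMCSP, proof of Thm. 5.2 (p. 18, gap and soundness)] -/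
theorem rpow_neg_le_gap {D : ℕ} (hD : 0 < D) {γ α : ℝ} (hγ : 0 < γ)
    (hαγ : α * (2 * D + 1) = γ / 2) {L : ℕ} (hL1 : 1 ≤ L) {s : ℕ} (hs1 : 1 ≤ s)
    (hs : (s : ℝ) ≤ Real.sqrt (3 * L))
    (hcond : (2 : ℝ) ^ (D + 1) * (D : ℝ) ^ D * ((3 : ℝ) * L) ^ (γ / 4) ≤ (L : ℝ) ^ γ) :
    (L : ℝ) ^ (-γ) ≤ (s : ℝ) ^ (-α) / 2 * ((s : ℝ) ^ (-α) / (2 * (s : ℝ) ^ α * D)) ^ D := by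
  set G : ℝ := (s : ℝ) ^ α with hG
  have hspos : (0 : ℝ) < s := by exact_mod_cast hs1
  have hGpos : 0 < G := Real.rpow_pos_of_pos hspos α
  have hDr : (0 : ℝ) < D := by exact_mod_cast hD
  have hE : (s : ℝ) ^ (-α) = G⁻¹ := Real.rpow_neg hspos.le α
  rw [hE]
  have hG0 : G ≠ 0 := hGpos.ne'
  have hR : G⁻¹ / 2 * (G⁻¹ / (2 * G * D)) ^ D =
      1 / ((2 : ℝ) ^ (D + 1) * (D : ℝ) ^ D * G ^ (2 * D + 1)) := by
    rw [div_pow, inv_pow, mul_pow, mul_pow,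
      show G ^ (2 * D + 1) = G ^ D * G ^ D * G by rw [two_mul, pow_succ, pow_add], pow_succ]
    field_simp
  rw [hR]
  have hLpos : (0 : ℝ) < L := by exact_mod_cast hL1
  have hLγ : (L : ℝ) ^ (-γ) = 1 / (L : ℝ) ^ γ := by
    rw [Real.rpow_neg hLpos.le, one_div]
  rw [hLγ]
  apply one_div_le_one_div_of_le (by positivity)
  have hGpow : G ^ (2 * D + 1) = (s : ℝ) ^ (γ / 2) := by
    rw [hG, ← Real.rpow_natCast, ← Real.rpow_mul hspos.le, ← hαγ]
    push_cast
    ring_nf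
  have hsγ : (s : ℝ) ^ (γ / 2) ≤ ((3 : ℝ) * L) ^ (γ / 4) := by
    calc (s : ℝ) ^ (γ / 2) ≤ (Real.sqrt (3 * L)) ^ (γ / 2) :=
          Real.rpow_le_rpow hspos.le hs (by linarith)
      _ = ((3 : ℝ) * L) ^ (γ / 4) := by
          rw [Real.sqrt_eq_rpow, ← Real.rpow_mul (by positivity)]
          congr 1
          ring
  calc (2 : ℝ) ^ (D + 1) * (D : ℝ) ^ D * G ^ (2 * D + 1)
      = (2 : ℝ) ^ (D + 1) * (D : ℝ) ^ D * (s : ℝ) ^ (γ / 2) := by rw [hGpow]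
    _ ≤ (2 : ℝ) ^ (D + 1) * (D : ℝ) ^ D * ((3 : ℝ) * L) ^ (γ / 4) :=
        mul_le_mul_of_nonneg_left hsγ (by positivity)
    _ ≤ (L : ℝ) ^ γ := hcond

/-- `sqrtLog (n · q₁) ≤ √(3 ⌊log₂ n⌋)` when `q₁ ≤ n` and `n ≥ 2` (as `⌊log₂ (n q₁)⌋ ≤
⌊log₂ n²⌋ ≤ 2⌊log₂ n⌋ + 1`): the CMMSA size `n' = n · |Σ|` has `Δ(n') = Θ((log n)^{1/2})`.
[cite: Hirahara2022PartialMCSP, proof of Thm. 5.2 (p. 18) and §5 (Δ(n) := (log n)^{1/2})] -/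
theorem sqrtLog_mul_le {n q₁ : ℕ} (hq : q₁ ≤ n) (hL1 : 1 ≤ Nat.log 2 n) :
    (sqrtLog (n * q₁) : ℝ) ≤ Real.sqrt (3 * (Nat.log 2 n : ℕ)) := by
  set L := Nat.log 2 n with hL
  have hn : n ≠ 0 := by
    rintro rfl
    simp [hL] at hL1
  have hlog : Nat.log 2 (n * q₁) ≤ 3 * L := by
    have hnn : n * q₁ ≤ n * n := Nat.mul_le_mul_left _ hq
    have hlt : n < 2 ^ (L + 1) := Nat.lt_pow_succ_log_self (by norm_num) n
    have hsq : n * n < 2 ^ (2 * L + 2) := by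
      calc n * n < 2 ^ (L + 1) * 2 ^ (L + 1) := Nat.mul_lt_mul'' hlt hlt
        _ = 2 ^ (2 * L + 2) := by rw [← pow_add]; ring_nf
    have h1 : Nat.log 2 (n * n) < 2 * L + 2 :=
      Nat.log_lt_of_lt_pow (Nat.mul_ne_zero hn hn) hsq
    have h2 : Nat.log 2 (n * q₁) ≤ Nat.log 2 (n * n) := Nat.log_mono_right hnn
    omega
  calc (sqrtLog (n * q₁) : ℝ) ≤ (Nat.sqrt (3 * L) : ℕ) := by
        exact_mod_cast Nat.sqrt_le_sqrt hlog
    _ ≤ Real.sqrt ((3 * L : ℕ) : ℝ) := Real.nat_sqrt_le_real_sqrt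
    _ = Real.sqrt (3 * (L : ℝ)) := by push_cast; rfl

/-! ### Correctness of the patched map on the promise -/

section Correctness

variable {D c N₀ Q₀ L₀ : ℕ} {γ α : ℝ}

/-- **Yes-instances are mapped to yes-instances.** [cite: Hirahara2022PartialMCSP, proof of Thm. 5.2 (p. 17, completeness; p. 18, parameters)] -/
theorem dinurSafraMap_mem_yesSet (hcγD : (c : ℝ) * γ * D ≤ 1 / 4) (hcγ1 : (c : ℝ) * γ ≤ 1)
    (hthr : ∀ L : ℕ, L₀ ≤ L → 1 ≤ L ∧ (D : ℝ) * (L : ℝ) ^ ((1 : ℝ) / 4) + 1 ≤ Real.sqrt L ∧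
      (2 : ℝ) ^ (D + 1) * (D : ℝ) ^ D * ((3 : ℝ) * L) ^ (γ / 4) ≤ (L : ℝ) ^ γ)
    (hN₀ : ∀ n : ℕ, N₀ < n → L₀ ≤ Nat.log 2 n ∧ 1 ≤ Nat.log 2 n)
    (hQ₀ : ∀ n : ℕ, n ≤ N₀ → ((Nat.log 2 n : ℕ) : ℝ) ^ ((c : ℝ) * γ) ≤ Q₀)
    {Ψ : CSPInstance}
    (hΨ : Ψ ∈ GapCSPQueried.yesSet D fun n => ((Nat.log 2 n : ℕ) : ℝ) ^ ((c : ℝ) * γ)) :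
    dinurSafraMap N₀ Q₀ Ψ ∈ CMMSA.yesSet sqrtLog := by
  obtain ⟨⟨hwf, hD', hq, hsat⟩, hall⟩ := hΨ
  dsimp only at hq
  by_cases hsmall : Ψ.numVars ≤ N₀
  · have hqQ : Ψ.alphabetSize ≤ Q₀ := by
      have : (Ψ.alphabetSize : ℝ) ≤ Q₀ := hq.trans (hQ₀ _ hsmall)
      exact_mod_cast this
    have h : dinurSafraMap N₀ Q₀ Ψ = trivialYesCMMSA := by
      unfold dinurSafraMap
      rw [if_pos ⟨hwf, hsmall, hqQ⟩, if_pos hsat]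
    rw [h]
    exact trivialYesCMMSA_mem_yesSet _
  · push Not at hsmall
    obtain ⟨hL₀, hL1⟩ := hN₀ _ hsmall
    obtain ⟨-, hcondb, -⟩ := hthr _ hL₀
    set L := Nat.log 2 Ψ.numVars with hL
    have hLr : (1 : ℝ) ≤ L := by exact_mod_cast hL1
    -- `|Σ| ≤ L ≤ n ≤ Σⱼ |dom Cⱼ|`
    have hqL : Ψ.alphabetSize ≤ L := by
      have : (Ψ.alphabetSize : ℝ) ≤ L :=
        hq.trans (by simpa using Real.rpow_le_rpow_of_exponent_le hLr hcγ1)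
      exact_mod_cast this
    have hLn : L ≤ Ψ.numVars := Nat.log_le_self 2 _
    have hnT : Ψ.numVars ≤ Ψ.totalArity := CSPInstance.numVars_le_sum_length_of_allVarsQueried hall
    have hfits : Ψ.numVars ≤ Ψ.totalArity ∧ Ψ.alphabetSize ≤ Ψ.totalArity :=
      ⟨hnT, hqL.trans (hLn.trans hnT)⟩
    have h : dinurSafraMap N₀ Q₀ Ψ = Ψ.toCMMSA := by
      unfold dinurSafraMap
      rw [if_neg (fun h => (not_le.2 hsmall) h.2.1), if_pos hfits]
    rw [h]
    refine CSPInstance.toCMMSA_mem_yesSet hwf hD' hsat ?_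
    calc Ψ.alphabetSize ^ D * D ≤ Nat.sqrt L := pow_mul_le_nat_sqrt hL1 hq hcγD hcondb
      _ = sqrtLog Ψ.numVars := rfl
      _ ≤ sqrtLog (Ψ.numVars * Ψ.litWidth) :=
          sqrtLog_mono (Nat.le_mul_of_pos_right _ Ψ.one_le_litWidth)

/-- **No-instances are mapped to no-instances.** [cite: Hirahara2022PartialMCSP, proof of Thm. 5.2 (pp. 17–18, soundness and parameters)] -/
theorem dinurSafraMap_mem_noSet (hD : 0 < D) (hγ : 0 < γ) (hαγ : α * (2 * D + 1) = γ / 2)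
    (hcγD : (c : ℝ) * γ * D ≤ 1 / 4) (hcγ1 : (c : ℝ) * γ ≤ 1)
    (hthr : ∀ L : ℕ, L₀ ≤ L → 1 ≤ L ∧ (D : ℝ) * (L : ℝ) ^ ((1 : ℝ) / 4) + 1 ≤ Real.sqrt L ∧
      (2 : ℝ) ^ (D + 1) * (D : ℝ) ^ D * ((3 : ℝ) * L) ^ (γ / 4) ≤ (L : ℝ) ^ γ)
    (hN₀ : ∀ n : ℕ, N₀ < n → L₀ ≤ Nat.log 2 n ∧ 1 ≤ Nat.log 2 n)
    (hQ₀ : ∀ n : ℕ, n ≤ N₀ → ((Nat.log 2 n : ℕ) : ℝ) ^ ((c : ℝ) * γ) ≤ Q₀)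
    {Ψ : CSPInstance}
    (hΨ : Ψ ∈ GapCSPQueried.noSet D (fun n => ((Nat.log 2 n : ℕ) : ℝ) ^ ((c : ℝ) * γ))
      fun n => ((Nat.log 2 n : ℕ) : ℝ) ^ (-γ)) :
    dinurSafraMap N₀ Q₀ Ψ ∈ CMMSA.noSet (fun n => (sqrtLog n : ℝ) ^ α) (fun n => (sqrtLog n : ℝ) ^ (-α))
      sqrtLog := by
  obtain ⟨⟨hwf, hD', hq, hno⟩, hall⟩ := hΨ
  dsimp only at hq hno
  -- the fixed no-instance qualifies: `ε(2) = 1 > 0`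
  have hε2 : (0 : ℝ) < (sqrtLog 2 : ℝ) ^ (-α) := by
    have hlog : Nat.log 2 2 = 1 := Nat.log_eq_of_pow_le_of_lt_pow (by norm_num) (by norm_num)
    have hs : sqrtLog 2 = 1 := by
      rw [sqrtLog, hlog]
      exact Nat.sqrt_eq' 1
    rw [hs, Nat.cast_one, Real.one_rpow]
    exact one_pos
  by_cases hsmall : Ψ.numVars ≤ N₀
  · have hqQ : Ψ.alphabetSize ≤ Q₀ := by
      have : (Ψ.alphabetSize : ℝ) ≤ Q₀ := hq.trans (hQ₀ _ hsmall)
      exact_mod_cast this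
    have hunsat : ¬ Ψ.IsSatisfiable := by
      rintro ⟨a, ha⟩
      have h1 : (Ψ.satCount a : ℝ) = Ψ.numConstraints := by
        exact_mod_cast (Ψ.satCount_eq_numConstraints_iff a).2 ha
      have h2 := hno a
      rw [h1] at h2
      have hδ : ((Nat.log 2 Ψ.numVars : ℕ) : ℝ) ^ (-γ) ≤ 1 := rpow_neg_natLog_le_one _ hγ
      have hm : (0 : ℝ) ≤ Ψ.numConstraints := Nat.cast_nonneg _
      have h3 : ((Nat.log 2 Ψ.numVars : ℕ) : ℝ) ^ (-γ) * Ψ.numConstraints ≤ 1 * Ψ.numConstraints :=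
        mul_le_mul_of_nonneg_right hδ hm
      linarith
    have h : dinurSafraMap N₀ Q₀ Ψ = trivialNoCMMSA := by
      unfold dinurSafraMap
      rw [if_pos ⟨hwf, hsmall, hqQ⟩, if_neg hunsat]
    rw [h]
    exact trivialNoCMMSA_mem_noSet hε2
  · push Not at hsmall
    obtain ⟨hL₀, hL1⟩ := hN₀ _ hsmall
    obtain ⟨-, hcondb, hcondc⟩ := hthr _ hL₀
    set L := Nat.log 2 Ψ.numVars with hL
    have hLr : (1 : ℝ) ≤ L := by exact_mod_cast hL1
    have hqL : Ψ.alphabetSize ≤ L := by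
      have : (Ψ.alphabetSize : ℝ) ≤ L :=
        hq.trans (by simpa using Real.rpow_le_rpow_of_exponent_le hLr hcγ1)
      exact_mod_cast this
    have hLn : L ≤ Ψ.numVars := Nat.log_le_self 2 _
    have hnT : Ψ.numVars ≤ Ψ.totalArity := CSPInstance.numVars_le_sum_length_of_allVarsQueried hall
    have hfits : Ψ.numVars ≤ Ψ.totalArity ∧ Ψ.alphabetSize ≤ Ψ.totalArity :=
      ⟨hnT, hqL.trans (hLn.trans hnT)⟩
    have h : dinurSafraMap N₀ Q₀ Ψ = Ψ.toCMMSA := by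
      unfold dinurSafraMap
      rw [if_neg (fun h => (not_le.2 hsmall) h.2.1), if_pos hfits]
    rw [h]
    have hdeg : Ψ.alphabetSize ^ D * D ≤ sqrtLog (Ψ.numVars * Ψ.litWidth) :=
      calc Ψ.alphabetSize ^ D * D ≤ Nat.sqrt L := pow_mul_le_nat_sqrt hL1 hq hcγD hcondb
        _ = sqrtLog Ψ.numVars := rfl
        _ ≤ sqrtLog (Ψ.numVars * Ψ.litWidth) :=
            sqrtLog_mono (Nat.le_mul_of_pos_right _ Ψ.one_le_litWidth)
    -- the CMMSA size `n' = n · q₁` and `s = Δ(n')`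
    have hn2 : 2 ≤ Ψ.numVars := by
      by_contra hlt
      push Not at hlt
      have : Nat.log 2 Ψ.numVars = 0 := Nat.log_of_lt hlt
      omega
    have hq₁n : Ψ.litWidth ≤ Ψ.numVars :=
      max_le (hqL.trans hLn) (le_trans (by norm_num) hn2)
    have hs1 : 1 ≤ sqrtLog (Ψ.numVars * Ψ.litWidth) := by
      rw [sqrtLog, Nat.le_sqrt, one_mul]
      exact Nat.log_pos one_lt_two
        (hn2.trans (Nat.le_mul_of_pos_right _ Ψ.one_le_litWidth))
    have hs : (sqrtLog (Ψ.numVars * Ψ.litWidth) : ℝ) ≤ Real.sqrt (3 * (L : ℕ)) :=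
      sqrtLog_mul_le hq₁n hL1
    have hspos : (0 : ℝ) < sqrtLog (Ψ.numVars * Ψ.litWidth) := by exact_mod_cast hs1
    exact CSPInstance.toCMMSA_mem_noSet hwf hD' hD hno hdeg (Real.rpow_pos_of_pos hspos _)
      (Real.rpow_pos_of_pos hspos _) (rpow_neg_le_gap hD hγ hαγ hL1 hs1 hs hcondc)

end Correctness

/-! ### Theorem 5.2 from Lemma 5.3 -/

/-- **Hirahara 2022, Thm. 5.2 at `Δ(n) = (log n)^{1/2}`, from Lemma 5.3** (sliding-scale PCP,
compact MaxCSP form `Hirahara2022_lem53_logPow_queried`) **and the polynomial-time computability of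
the patched Dinur–Safra map** (`dinurSafraMap_mem_FP`): for `γ := 1/(4(c+1)D)` and `α := γ/(2(2D+1))`
the map `dinurSafraMap N₀ Q₀` is a Karp reduction of promise problems from `gapCSPQueried D ((log₂ n)^{cγ})
((log₂ n)^{-γ})` to `gapCMMSA (Δ^α) (Δ^{-α}) Δ`, `Δ = sqrtLog` (`dinurSafraMap_mem_yesSet`,
`dinurSafraMap_mem_noSet`), so the NP-hardness of the former (Lemma 5.3) transfers
(`IsHard.of_reducible_holds`). This discharges `Hirahara2022_thm52_sqrtLog` relative to the two
named facts. [cite: Hirahara2022PartialMCSP, Thm. 5.2 and its proof (pp. 16–18)] -/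
theorem Hirahara2022_thm52_sqrtLog_of_lem53 (h53 : Hirahara2022_lem53_logPow_queried)
    (hFP : dinurSafraMap_mem_FP) : MetaComplexity.Hirahara2022_thm52_sqrtLog := by
  obtain ⟨D, c, hD, hhard⟩ := h53
  have hDr : (1 : ℝ) ≤ D := by exact_mod_cast hD
  have hc0 : (0 : ℝ) ≤ c := Nat.cast_nonneg _
  -- the exponents
  set γ : ℝ := 1 / (4 * ((c : ℝ) + 1) * D) with hγdef
  have hγ : 0 < γ := by positivity
  have hcγ0 : 0 ≤ (c : ℝ) * γ := by positivity
  have hcγD : (c : ℝ) * γ * D ≤ 1 / 4 := by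
    have hD0 : (D : ℝ) ≠ 0 := by exact_mod_cast hD.ne'
    rw [hγdef]
    rw [show (c : ℝ) * (1 / (4 * ((c : ℝ) + 1) * D)) * D = (c : ℝ) / ((c : ℝ) + 1) / 4 by
      field_simp]
    have : (c : ℝ) / ((c : ℝ) + 1) ≤ 1 := (div_le_one (by positivity)).2 (by linarith)
    linarith
  have hcγ1 : (c : ℝ) * γ ≤ 1 := by
    have : (c : ℝ) * γ ≤ (c : ℝ) * γ * D := le_mul_of_one_le_right hcγ0 hDr
    linarith
  set α : ℝ := γ / (2 * (2 * D + 1)) with hαdef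
  have hα : 0 < α := by positivity
  have hD0 : (D : ℝ) ≠ 0 := by exact_mod_cast hD.ne'
  have hαγ : α * (2 * D + 1) = γ / 2 := by
    rw [hαdef]
    field_simp
  refine ⟨α, hα, ?_⟩
  -- the thresholds `L₀`, `N₀ = 2^{max L₀ 1}`, `Q₀ = ⌈(log₂ N₀)^{cγ}⌉`
  obtain ⟨L₀, hthr⟩ := exists_threshold D hγ
  set N₀ : ℕ := 2 ^ max L₀ 1 with hN₀def
  set Q₀ : ℕ := ⌈((Nat.log 2 N₀ : ℕ) : ℝ) ^ ((c : ℝ) * γ)⌉₊ with hQ₀def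
  have hN₀ : ∀ n : ℕ, N₀ < n → L₀ ≤ Nat.log 2 n ∧ 1 ≤ Nat.log 2 n := by
    intro n hn
    have h : max L₀ 1 ≤ Nat.log 2 n := Nat.le_log_of_pow_le one_lt_two hn.le
    exact ⟨(le_max_left _ _).trans h, (le_max_right _ _).trans h⟩
  have hQ₀ : ∀ n : ℕ, n ≤ N₀ → ((Nat.log 2 n : ℕ) : ℝ) ^ ((c : ℝ) * γ) ≤ Q₀ := by
    intro n hn
    calc ((Nat.log 2 n : ℕ) : ℝ) ^ ((c : ℝ) * γ) ≤ ((Nat.log 2 N₀ : ℕ) : ℝ) ^ ((c : ℝ) * γ) :=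
          Real.rpow_le_rpow (Nat.cast_nonneg _) (by exact_mod_cast Nat.log_mono_right hn) hcγ0
      _ ≤ Q₀ := Nat.le_ceil _
  -- the Karp reduction
  obtain ⟨f, hf, hfΨ⟩ := hFP N₀ Q₀
  refine PromiseProblem.IsHard.of_reducible_holds (hhard γ hγ) ⟨f, hf, ?_, ?_⟩
  · intro v hv
    rw [gapCSPQueried_yes] at hv
    obtain ⟨Ψ, hΨ, rfl⟩ := hv
    rw [hfΨ, gapCMMSA_yes]
    exact Set.mem_image_of_mem _ (dinurSafraMap_mem_yesSet hcγD hcγ1 hthr hN₀ hQ₀ hΨ)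
  · intro v hv
    rw [gapCSPQueried_no] at hv
    obtain ⟨Ψ, hΨ, rfl⟩ := hv
    rw [hfΨ, gapCMMSA_no]
    exact Set.mem_image_of_mem _ (dinurSafraMap_mem_noSet hD hγ hαγ hcγD hcγ1 hthr hN₀ hQ₀ hΨ)



end Literature.Computability.Complexity
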